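import Literature.Geometry.GaugeTheory.SpincStructureGradNormSq
import HarnessLib

/-!
# The Dirac operator of a smooth spinor field is a smooth spinor field

Topic `Literature/Geometry/GaugeTheory`; packages Morgan's (3.3) `∂_A ψ = Σ_k γ_k ∇̃_{e_k} ψ` —
defined in the tree chart by chart (`dirac A ψ i x`) and proved to glue
(`SpinConnectionChartIndependence.mulVec_dirac_eq`: `G_ij ∂_Aψ_j = ∂_Aψ_i`) — as a global spinor field
`diracField A hψ : SpinorField 𝔰` for a smooth `ψ` ("the Dirac operator
`∂_A : C^∞(S(P̃)) → C^∞(S(P̃))`", Morgan 1996, §3.3), and proves it is smooth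
(`isSmooth_diracField`: the components of `∇̃_{e_k}ψ_i` are smooth, `contMDiffAt_covDeriv_frame_apply`).

PROVED, 0 named facts.

## References

* J. W. Morgan, *The Seiberg–Witten Equations and Applications to the Topology of Smooth
  Four-Manifolds* (1996), §3.3 (3.3), Lemma 3.3.1. [MorganSWBook1996]
-/

noncomputable section

open scoped Manifold ContDiff Topology Matrix
open Set Function
open Literature.Geometry.Lorentzian (PseudoRiemannianMetric)
open Literature.Topology.FourManifolds (SmoothOrientation)

namespace Literature.Geometry.GaugeTheory

namespace SpincStructure

variable {X : Type*} [TopologicalSpace X] [ChartedSpace (EuclideanSpace ℝ (Fin 4)) X] [IsManifold (𝓡 4) ∞ X]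
  {g : PseudoRiemannianMetric (𝓡 4) ∞ (EuclideanSpace ℝ (Fin 4)) (TangentSpace (𝓡 4) : X → Type _)}
  {o : SmoothOrientation (𝓡 4) X} {ι : Type*} (𝔰 : SpincStructure g o ι) [g.HasLeviCivita]

/-- **The Dirac operator `∂_A ψ` of a smooth spinor field, as a spinor field** (the chart values
`∂_A ψ_i = Σ_k γ_k ∇̃_{e_k}ψ_i` glue by `G_ij ∂_Aψ_j = ∂_Aψ_i`). [cite: MorganSWBook1996, §3.3 (3.3)] -/
def diracField (A : 𝔰.detLineBundle.Connection) {ψ : SpinorField 𝔰} (hψ : ψ.IsSmooth) : SpinorField 𝔰 where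
  toFun i x := dirac A ψ i x
  mulVec_toFun i j _ hx := 𝔰.mulVec_dirac_eq A hψ i j hx

/-- The chart values of `∂_A ψ`. [cite: MorganSWBook1996, §3.3 (3.3)] -/
@[simp] theorem diracField_toFun (A : 𝔰.detLineBundle.Connection) {ψ : SpinorField 𝔰} (hψ : ψ.IsSmooth) (i : ι) (x : X) :
    (𝔰.diracField A hψ).toFun i x = dirac A ψ i x :=
  rfl

/-- **The components of `∂_A ψ_i` are smooth** at the points of the chart. [cite: MorganSWBook1996, §3.3] -/
theorem contMDiffAt_dirac_apply (A : 𝔰.detLineBundle.Connection) {ψ : SpinorField 𝔰} (hψ : ψ.IsSmooth) (i : ι)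
    {x : X} (hx : x ∈ 𝔰.baseSet i) (a : Spinor) :
    ContMDiffAt (𝓡 4) 𝓘(ℝ, ℂ) ∞ (fun y ↦ dirac A ψ i y a) x := by
  have heq : (fun y ↦ dirac A ψ i y a) = fun y ↦ ∑ k, ∑ b, cliffordBasis k a b * covDeriv A ψ i y (𝔰.frame i k y) b := by
    funext y
    simp only [dirac, Finset.sum_apply]
    rfl
  rw [heq]
  exact ContMDiffAt.sum fun k _ ↦ ContMDiffAt.sum fun b _ ↦
    ContMDiffAt.mul_complex contMDiffAt_const (𝔰.contMDiffAt_covDeriv_frame_apply A hψ i hx k b)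

/-- **`∂_A ψ` is a smooth spinor field** for smooth `ψ` (`∂_A : C^∞(S(P̃)) → C^∞(S(P̃))`).
[cite: MorganSWBook1996, §3.3] -/
theorem isSmooth_diracField (A : 𝔰.detLineBundle.Connection) {ψ : SpinorField 𝔰} (hψ : ψ.IsSmooth) :
    (𝔰.diracField A hψ).IsSmooth := fun i a _ hx ↦
  (𝔰.contMDiffAt_dirac_apply A hψ i hx a).contMDiffWithinAt

end SpincStructure

end Literature.Geometry.GaugeTheory

end
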